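import Mathlib
import Summits.KontsevichZagierPeriods.Zeta5Search.Elimination.PencilConnection
import Summits.KontsevichZagierPeriods.Zeta5Search.WedgeDictionaryThreeTerm
import Summits.KontsevichZagierPeriods.Zeta5Search.WedgeDictionaryGroupTransport
import HarnessLib

/-!
# ζ(5) search — class `elim`: THE PENCIL RELATION IN EVERY SLOT (E-L18, part 1 of 3: transport of E-L17
# along `S₇`; cell `pub-zeta5`, fam-elim gen 22/23; add-on to E-L17 `Elimination/PencilConnection.lean` and to
# the D2 lane's `WedgeDictionaryThreeTerm.lean`, whose nodes `DictPencil`, `DictStar` are conjectural there)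

HONEST FRAMING: systematic search; no irrationality claim unless certified.

OUR work (Summit side; `families/elim/FAMILY.md` §17).  Notation as in E-L17: `D(x) = (U, W, V)(x)`
(`coeffU/W/V`), `C(x) = D(x) ∧ D(x + e₇)` with Plücker coordinates `casUW`, `casUV`, `casVW` (the
`ζ(3)`-eliminant of the contiguous pair `(x, x+e₇)` and its companion minor), `x⁺ = dsShift x`, `d = dOf`,
`ρ = rhoB = rhoCore · prodFNat`.

1. `pencil_perm` — THE ρ-FREE PENCIL IN EVERY SLOT.  E-L17 (`pencil_UW/UV/VW`, slot 7) transported along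
   any `σ ∈ S₇` (`permLower`; `coeffU/W/V_permLower`, `shift_permLower`) and brought back to slot-7 wedges by
   the partner-freeness of wedges (`wedge_slot_free`, `wedge_free` + `coeff_update_sub`): for `x` in the box,
   `s = σ(6)`, `x_{s+1} + 2 ≤ x₀`, `d(x) ≥ 2`, all pair sums `x_j + x_k ≤ x₀`, and `X ∈ {U∧W, U∧V, V∧W}`:
   `Π₇(σ•x) · X(x⁺) = (∏_{k≤6}((σ•x)_k + 1)) · X(x + e_{s+1}) + (d(x) − 1)(x₀ − x_{s+1} + 1) · X(x⁺ + e_{s+1})`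
   — the three eliminants at `c = x + e_{s+1}`, `P = c⁺`, `P − e_{s+1} = x⁺` are `ℚ`-dependent with product
   coefficients (`Π₇(σ•x) = ∏_{k ≠ s}(x₀ − x_{s+1} − x_{k+1})`).
2. Bookkeeping used by parts 2–3 (`Elimination/PencilGauge.lean`, `Elimination/PencilBridge.lean`): the
   diagonal translate commutes with slot steps and relabellings (`bump_dsShift_slot`, `dsShift_update`,
   `permLower_dsShift`, `permLower_bump`), the box is kept (`inBox_bump`, `inBox_permLower`,
   `pairs_permLower`), relabelled slot-7 wedges are slot-7 wedges (`cas_permLower`: the wedge of `σ • y` in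
   slot 7 is the wedge of `y` in slot `σ(6)+1`, which is partner-free), and all values depend on `b₀,…,b₇`
   only (`cas_congr`, `dOf_congr`, `rhoB_congr`, `fanCoeff_congr`).
Parts 2–3 turn item 1 into gen-1's `DictPencil` / `DictStar` pointwise on the interior.  What this is NOT:
anything about sizes, denominators, valuations or irrationality; the class verdict is unchanged
(T1 NO / T2 NO / T4 YES).
-/

noncomputable section

open Finset

namespace Summit.KontsevichZagierPeriods.Zeta5Search.Elimination

open Summit.KontsevichZagierPeriods.Zeta5Search.DualSeries (InBox numPoly)
open Summit.KontsevichZagierPeriods.Zeta5Search.WedgeDictionary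
open Summit.KontsevichZagierPeriods.Zeta5Search.SymmetricGauge
open Summit.KontsevichZagierPeriods.Zeta5Search.CasoratianValuation (shift)
open Literature.NumberTheory.Irrationality.BrownZudilin2022 (bOfA Converges QOf convergenceForms)

/-! ### 0. Small bookkeeping -/

/-- Index bounds of the fifteen edge pairs. -/
theorem epairs_bounds :
    ∀ jk ∈ Epairs, 1 ≤ jk.1 ∧ jk.1 ≤ 7 ∧ 1 ≤ jk.2 ∧ jk.2 ≤ 7 ∧ jk.1 < jk.2 := by
  decide

/-- Every pair `1 ≤ j < k ≤ 7` is an edge pair or one of the six non-edge pairs. -/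
theorem pair_mem_epairs_or_nonEpairs (j k : ℕ) (h1 : 1 ≤ j) (hjk : j < k) (hk : k ≤ 7) :
    (j, k) ∈ Epairs ∨ (j, k) ∈ nonEpairs := by
  have hj7 : j < 7 := by omega
  interval_cases j <;> interval_cases k <;> decide

/-- The diagonal translate commutes with every unit slot step: `(b + e_{m+1})⁺ = b⁺ + e_{m+1}`. -/
theorem bump_dsShift_slot (b : ℕ → ℤ) (m : ℕ) : bump (dsShift b) m = dsShift (bump b m) := by
  funext j
  by_cases hj : j = m + 1
  · subst hj
    rw [bump_self, dsShift_succ, dsShift_succ, bump_self]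
  · rw [bump_of_ne _ hj]
    rcases j with _ | j
    · rw [dsShift_zero, dsShift_zero, bump_zero]
    · rw [dsShift_succ, dsShift_succ, bump_of_ne _ hj]

/-- `(update c (s+1) v)⁺ = update c⁺ (s+1) (v+1)`. -/
theorem dsShift_update (c : ℕ → ℤ) (s : ℕ) (v : ℤ) :
    dsShift (Function.update c (s + 1) v) = Function.update (dsShift c) (s + 1) (v + 1) := by
  funext j
  rcases j with _ | j
  · rw [dsShift_zero, Function.update_of_ne (by omega), Function.update_of_ne (by omega), dsShift_zero]
  · rw [dsShift_succ, Function.update_apply, Function.update_apply]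
    split_ifs with h
    · rfl
    · rw [dsShift_succ]

/-- A unit slot step keeps the box as long as the slot was `≤ b₀`. -/
theorem inBox_bump {x : ℕ → ℤ} (hx : InBox x) {m : ℕ} (h : x (m + 1) ≤ x 0) : InBox (bump x m) := by
  refine ⟨by rw [bump_zero]; exact hx.1, fun j hj => ?_⟩
  rw [bump_zero]
  rcases eq_or_ne j m with rfl | hne
  · rw [bump_self]; have := hx.2 j hj; omega
  · rw [bump_of_ne _ (by omega : j + 1 ≠ m + 1)]; exact hx.2 j hj

/-! ### 1. Relabelling bookkeeping and the transport of E-L17 to every slot -/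

/-- `σ • (x⁺) = (σ • x)⁺`. -/
theorem permLower_dsShift (σ : Equiv.Perm (Fin 7)) (x : ℕ → ℤ) :
    permLower σ (dsShift x) = dsShift (permLower σ x) := by
  funext k
  by_cases hk : 1 ≤ k ∧ k ≤ 7
  · obtain ⟨m, rfl⟩ : ∃ m : Fin 7, k = m.val + 1 := ⟨⟨k - 1, by omega⟩, by simp only; omega⟩
    rw [permLower_apply_succ, dsShift_succ, dsShift_succ, permLower_apply_succ]
  · rw [permLower_apply_of_not σ _ hk]
    rcases k with _ | m
    · rw [dsShift_zero, dsShift_zero, permLower_zero]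
    · rw [dsShift_succ, dsShift_succ, permLower_apply_of_not σ _ hk]

/-- `(σ • x) + e_{m+1} = σ • (x + e_{σ(m)+1})` (`shift_permLower` in `bump` notation). -/
theorem permLower_bump (σ : Equiv.Perm (Fin 7)) (x : ℕ → ℤ) (m : Fin 7) :
    bump (permLower σ x) m.val = permLower σ (bump x (σ m).val) :=
  shift_permLower x σ m

/-- Relabelling keeps the box. -/
theorem inBox_permLower (σ : Equiv.Perm (Fin 7)) {x : ℕ → ℤ} (hx : InBox x) : InBox (permLower σ x) := by
  refine ⟨by rw [permLower_zero]; exact hx.1, fun j hj => ?_⟩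
  have e := permLower_apply_succ σ x ⟨j, mem_range.1 hj⟩
  rw [e, permLower_zero]
  exact hx.2 _ (mem_range.2 (σ ⟨j, mem_range.1 hj⟩).isLt)

/-- Relabelling keeps "all pair sums `≤ x₀`". -/
theorem pairs_permLower (σ : Equiv.Perm (Fin 7)) {x : ℕ → ℤ}
    (hp : ∀ j k : ℕ, 1 ≤ j → j ≤ 7 → 1 ≤ k → k ≤ 7 → j ≠ k → x j + x k ≤ x 0) :
    ∀ jk ∈ allPairs, permLower σ x jk.1 + permLower σ x jk.2 ≤ permLower σ x 0 := by
  intro jk hjk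
  obtain ⟨h1, h12, h27⟩ := allPairs_bounds jk hjk
  obtain ⟨m₁, hm₁⟩ : ∃ m : Fin 7, jk.1 = m.val + 1 := ⟨⟨jk.1 - 1, by omega⟩, by simp only; omega⟩
  obtain ⟨m₂, hm₂⟩ : ∃ m : Fin 7, jk.2 = m.val + 1 := ⟨⟨jk.2 - 1, by omega⟩, by simp only; omega⟩
  rw [hm₁, hm₂, permLower_apply_succ, permLower_apply_succ, permLower_zero]
  have hne : σ m₁ ≠ σ m₂ := fun h => by
    have := σ.injective h
    rw [this] at hm₁
    omega
  exact hp _ _ (by omega) (by have := (σ m₁).isLt; omega) (by omega) (by have := (σ m₂).isLt; omega)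
    (fun h => hne (Fin.ext (by omega)))

/-- **Relabelled slot-7 wedges are the slot-7 wedges**: `X(σ • y) = X(y)` for `X ∈ {U∧W, U∧V, V∧W}`, `y` in
the box with `d(y) ≥ 0`, `y_{σ(6)+1} ≤ y₀`, `y₇ ≤ y₀` (the wedge of `σ • y` in slot 7 is the wedge of `y` in
slot `σ(6)+1`, which is partner-free). -/
theorem cas_permLower (σ : Equiv.Perm (Fin 7)) (y : ℕ → ℤ) (hy : InBox y) (hd : 0 ≤ dOf y)
    (hs : y ((σ 6).val + 1) ≤ y 0) (h7 : y 7 ≤ y 0) :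
    casUW (permLower σ y) = casUW y ∧ casUV (permLower σ y) = casUV y ∧ casVW (permLower σ y) = casVW y := by
  have e : bump (permLower σ y) 6 = permLower σ (bump y (σ 6).val) := permLower_bump σ y 6
  have hj : (σ 6).val + 1 ∈ Icc 1 7 := mem_Icc.2 ⟨by omega, by have := (σ 6).isLt; omega⟩
  obtain ⟨fUW, fUV⟩ := wedge_slot_free y hy hd hj hs h7
  obtain ⟨-, SW, SV⟩ := coeff_update_sub y hy hd (i := (σ 6).val) (k := 6) (mem_range.2 (σ 6).isLt)
    (mem_range.2 (by norm_num)) hs (by simpa using h7)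
  have fVW := wedge_free coeffV coeffW y ((σ 6).val + 1) (6 + 1) _ SV SW
  refine ⟨?_, ?_, ?_⟩
  · unfold casUW; rw [e]; simp only [coeffU_permLower, coeffW_permLower]; exact fUW
  · unfold casUV; rw [e]; simp only [coeffU_permLower, coeffV_permLower]; exact fUV
  · unfold casVW; rw [e]; simp only [coeffV_permLower, coeffW_permLower]; exact fVW

/-- **PENCIL IN EVERY SLOT, ρ-free** (E-L17 transported along `σ ∈ S₇`; `s = σ(6)`).  For `x` in the box
with `x_{s+1} + 2 ≤ x₀`, `d(x) ≥ 2` and all pair sums `x_j + x_k ≤ x₀`, each `X ∈ {U∧W, U∧V, V∧W}` satisfies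
`Π₇(σ•x)·X(x⁺) = (∏_{k≤6}((σ•x)_k+1))·X(x + e_{s+1}) + (d(x)−1)(x₀ − x_{s+1} + 1)·X(x⁺ + e_{s+1})`. -/
theorem pencil_perm (σ : Equiv.Perm (Fin 7)) (x : ℕ → ℤ) (hx : InBox x) (h7 : x ((σ 6).val + 1) + 2 ≤ x 0)
    (hd : 2 ≤ dOf x)
    (hp : ∀ j k : ℕ, 1 ≤ j → j ≤ 7 → 1 ≤ k → k ≤ 7 → j ≠ k → x j + x k ≤ x 0) :
    (pencilPi (permLower σ x) * casUW (dsShift x) =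
        (∏ k ∈ range 6, ((permLower σ x (k + 1) : ℚ) + 1)) * casUW (bump x (σ 6).val) +
          ((dOf x : ℚ) - 1) * ((x 0 : ℚ) - x ((σ 6).val + 1) + 1) * casUW (bump (dsShift x) (σ 6).val)) ∧
      (pencilPi (permLower σ x) * casUV (dsShift x) =
          (∏ k ∈ range 6, ((permLower σ x (k + 1) : ℚ) + 1)) * casUV (bump x (σ 6).val) +
            ((dOf x : ℚ) - 1) * ((x 0 : ℚ) - x ((σ 6).val + 1) + 1) * casUV (bump (dsShift x) (σ 6).val)) ∧
        (pencilPi (permLower σ x) * casVW (dsShift x) =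
          (∏ k ∈ range 6, ((permLower σ x (k + 1) : ℚ) + 1)) * casVW (bump x (σ 6).val) +
            ((dOf x : ℚ) - 1) * ((x 0 : ℚ) - x ((σ 6).val + 1) + 1) * casVW (bump (dsShift x) (σ 6).val)) := by
  set s : ℕ := (σ 6).val with hs_def
  have hs7 : s < 7 := (σ 6).isLt
  set b := permLower σ x with hb_def
  have hbx : InBox b := inBox_permLower σ hx
  have hb0 : b 0 = x 0 := permLower_zero σ x
  have hb7 : b 7 = x (s + 1) := permLower_apply_succ σ x 6
  have hdb : dOf b = dOf x := dOf_permLower σ x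
  have hpb : ∀ jk ∈ allPairs, b jk.1 + b jk.2 ≤ b 0 := pairs_permLower σ hp
  have hx1 : 0 ≤ x 1 := (hx.2 0 (by simp)).1
  have hx7 : x 7 ≤ x 0 := by
    have := hp 7 1 (by norm_num) (by norm_num) (by norm_num) (by norm_num) (by norm_num); omega
  have hxs : x (s + 1) ≤ x 0 := by omega
  have H7 : b 7 + 2 ≤ b 0 := by rw [hb7, hb0]; exact h7
  have Hd : 2 ≤ dOf b := by rw [hdb]; exact hd
  have HUW := pencil_UW b hbx H7 Hd hpb
  have HUV := pencil_UV b hbx H7 Hd hpb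
  have HVW := pencil_VW b hbx H7 Hd hpb
  have e1 : dsShift b = permLower σ (dsShift x) := by rw [hb_def, permLower_dsShift]
  have e2 : bump b 6 = permLower σ (bump x s) := permLower_bump σ x 6
  have e3 : bump (dsShift b) 6 = permLower σ (bump (dsShift x) s) := by
    rw [e1]; exact permLower_bump σ (dsShift x) 6
  have d7 : dsShift x 7 = x 7 + 1 := dsShift_of_pos x (by norm_num)
  have x7b := (hx.2 6 (by simp)).2
  obtain ⟨n1UW, n1UV, n1VW⟩ := cas_permLower σ (dsShift x) (inBox_dsShift hx) (by rw [dOf_dsShift]; omega)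
    (by rw [dsShift_succ, dsShift_zero, ← hs_def]; omega) (by rw [dsShift_zero, d7]; omega)
  obtain ⟨n2UW, n2UV, n2VW⟩ := cas_permLower σ (bump x s) (inBox_bump hx hxs)
    (by rw [dOf_bump x (mem_range.2 hs7)]; omega) (by rw [bump_self, bump_zero]; omega)
    (by rw [bump_zero]; simp only [bump, Function.update_apply]; split_ifs <;> omega)
  obtain ⟨n3UW, n3UV, n3VW⟩ := cas_permLower σ (bump (dsShift x) s)
    (inBox_bump (inBox_dsShift hx) (by rw [dsShift_succ, dsShift_zero]; omega))
    (by rw [dOf_bump _ (mem_range.2 hs7), dOf_dsShift]; omega)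
    (by rw [bump_self, bump_zero, dsShift_succ, dsShift_zero]; omega)
    (by rw [bump_zero, dsShift_zero]; simp only [bump, Function.update_apply, dsShift_succ]; split_ifs <;> omega)
  rw [e3, e2, e1, hdb, hb0, hb7] at HUW HUV HVW
  rw [n1UW, n2UW, n3UW] at HUW
  rw [n1UV, n2UV, n3UV] at HUV
  rw [n1VW, n2VW, n3VW] at HVW
  exact ⟨HUW, HUV, HVW⟩

/-! ### 2. Values depend on `b₀,…,b₇` only -/

/-- Agreement on `b₀,…,b₇` survives the slot-7 step. -/
theorem bump6_congr {y y' : ℕ → ℤ} (h : ∀ j, j ≤ 7 → y j = y' j) :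
    ∀ j, j ≤ 7 → bump y 6 j = bump y' 6 j := by
  intro j hj
  rcases eq_or_ne j (6 + 1) with rfl | hne
  · rw [bump_self, bump_self, h _ (by norm_num)]
  · rw [bump_of_ne _ hne, bump_of_ne _ hne, h j hj]

/-- The three slot-7 wedges depend on `b₀,…,b₇` only. -/
theorem cas_congr {y y' : ℕ → ℤ} (h : ∀ j, j ≤ 7 → y j = y' j) :
    casUW y = casUW y' ∧ casUV y = casUV y' ∧ casVW y = casVW y' := by
  have h0 := h 0 (by norm_num)
  have hn := numPoly_congr h
  have h0' := bump6_congr h 0 (by norm_num)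
  have hn' := numPoly_congr (bump6_congr h)
  unfold casUW casUV casVW
  rw [coeffU_congr' h0 hn, coeffW_congr' h0 hn, DualSeriesLemma19.coeffV_congr' h0 hn,
    coeffU_congr' h0' hn', coeffW_congr' h0' hn', DualSeriesLemma19.coeffV_congr' h0' hn']
  exact ⟨rfl, rfl, rfl⟩

/-- `d` depends on `b₀,…,b₇` only. -/
theorem dOf_congr {y y' : ℕ → ℤ} (h : ∀ j, j ≤ 7 → y j = y' j) : dOf y = dOf y' := by
  unfold dOf
  rw [h 0 (by norm_num), sum_congr rfl (fun j hj => h (j + 1) (by have := mem_range.1 hj; omega))]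

/-- `ρ` depends on `b₀,…,b₇` only. -/
theorem rhoB_congr {y y' : ℕ → ℤ} (h : ∀ j, j ≤ 7 → y j = y' j) : rhoB y = rhoB y' := by
  unfold rhoB
  rw [dOf_congr h]
  have hs : ∑ j ∈ range 7, y (j + 1) = ∑ j ∈ range 7, y' (j + 1) :=
    sum_congr rfl fun j hj => h (j + 1) (by have := mem_range.1 hj; omega)
  have hE : (Epairs.map fun jk => (((y 0 - y jk.1 - y jk.2).toNat.factorial : ℕ) : ℚ)) =
      (Epairs.map fun jk => (((y' 0 - y' jk.1 - y' jk.2).toNat.factorial : ℕ) : ℚ)) :=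
    List.map_congr_left fun jk hjk => by
      obtain ⟨-, h17, -, h27, -⟩ := epairs_bounds jk hjk
      rw [h 0 (by norm_num), h _ h17, h _ h27]
  have hS : (([1, 4, 5, 6, 7] : List ℕ).map fun j => (((y j).toNat.factorial : ℕ) : ℚ)) =
      (([1, 4, 5, 6, 7] : List ℕ).map fun j => (((y' j).toNat.factorial : ℕ) : ℚ)) :=
    List.map_congr_left fun j hj => by
      have : j ≤ 7 := by simp only [List.mem_cons, List.not_mem_nil, or_false] at hj; omega
      rw [h j this]
  rw [hs, hE, hS]

/-- `fanCoeff` depends on `P₀,…,P₇` only. -/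
theorem fanCoeff_congr {P P' : ℕ → ℤ} (h : ∀ j, j ≤ 7 → P j = P' j) {i : ℕ} (hi : i ∈ Icc 1 7) :
    fanCoeff P i = fanCoeff P' i := by
  have hi' := mem_Icc.1 hi
  unfold fanCoeff chiOf
  rw [h 0 (by norm_num), h i hi'.2]
  congr 1
  refine congrArg List.prod (List.map_congr_left fun m hm => ?_)
  have hm7 : m ≤ 7 := by
    obtain ⟨h1, h7⟩ := hi'
    interval_cases i <;> simp [nonEdgePartners] at hm <;> omega
  rw [h m hm7]

end Summit.KontsevichZagierPeriods.Zeta5Search.Elimination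

end
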